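import Literature.NumberTheory.ComplexMultiplication.DadeTausskyZassenhausCubicFundamentalUnit
import Literature.NumberTheory.ComplexMultiplication.CMAlgebraLatticeClassesClassGroup
import Literature.NumberTheory.ComplexMultiplication.FiniteQAlgebraLatticeMaximalOrderInvertible
import Literature.NumberTheory.ComplexMultiplication.FiniteQAlgebraLatticeClassNumberFormula
import Literature.NumberTheory.ComplexMultiplication.FiniteQAlgebraLatticeMetricDual
import Literature.NumberTheory.ComplexMultiplication.FiniteQAlgebraLatticeWeakClassCount
import HarnessLib

/-!
# HL26b §8 for `β³ + 2β² + 2β + 2 = 0`: `|G([Λ₁]_ε)| = 1`, the unit indices `[Λ₁^{unit} : Λᵢ^{unit}] = 2, 4, 4`,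
# the finite unit groups `(Λ/Cᵢ)^{unit}`, `|G([Λ₂]_ε)| = |G([Λ₃]_ε)| = 1`, `|G([Λ₄]_ε)| = 2`, and `τ₁ = τ₂ = τ₄ = 1`:
# the `ε`-classes over the cyclic orders `Λ₁, Λ₂, Λ₄` number `1, 1, 2`

Hertling–Larabi [HL26b, §8] determine the set `{[L]_ε | L ∈ 𝓛(A), 𝒪(L) ⊇ Λ_4}` for `A = ℚ[α]`, `α = 2β`,
`β³ + 2β² + 2β + 2 = 0`.  Chunk p0024: «`|G([Λ_max]_ε)| = (class number of A) = 1`» (cited from [LMFDB23]); chunk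
p0025: «By Theorem 5.12, `|G([Λ_i]_ε)| = |G([Λ_1]_ε)| · (1/[Λ_1^{unit} : Λ_i^{unit}]) · |(Λ_1/C_i)^{unit}|/|(Λ_i/C_i)^{unit}|`.
By [LMFDB23] `Λ_1^{unit} = {±(β+1)^l | l ∈ ℤ}`. Observe […] so `Λ_2^{unit} = {±(β+1)^{2l} | l ∈ ℤ}`,
`[Λ_1^{unit} : Λ_2^{unit}] = 2`, `Λ_3^{unit} = Λ_4^{unit} = {±(β+1)^{4l} | l ∈ ℤ}`,
`[Λ_1^{unit} : Λ_3^{unit}] = [Λ_1^{unit} : Λ_4^{unit}] = 4`.»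

This file supplies, in the DEF-FREE vocabulary of the tree's class number formula
`FiniteQAlgebraLattice.natCard_quot_pic_mul_mul_index_eq` (HL26b Thm. 5.12 (e) (5.22)), the first two factors for
the cubic field `K = ℚ(θ)`, `θ³ + 2θ² + 2θ + 2 = 0`, and its orders `Λ₁ = ⟨1, θ, θ²⟩ ⊇ Λ₂ = ⟨1, 2θ, θ²⟩ ⊇ Λ₃ = ⟨1, 2θ, 2θ²⟩ ⊇
Λ₄ = ⟨1, 2θ, 4θ²⟩`:

* §1 `span₁_eq_toSubmodule_integralClosure` (`Λ₁ = Λ_max` as `ℤ`-submodules, from `…CubicMaximalOrder`),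
  `isFullLattice_span₁` … `isFullLattice_span₄` (the four orders are full lattices).
* §2 **`natCard_pic_span₁_eq_one`**: `|G([Λ₁]_ε)| = 1` — the `ε`-classes of invertible full lattices `M` with
  `𝒪(M) = M:M = Λ₁` number `1` (class number one, `classNumber_eq_one`, through the tree's
  `natCard_quot_isFullLattice_eq_classNumber`, HL 2026 Thm. 6.1 (c)); `exists_units_smul_span₁_eq`: every full lattice
  `M` with `MΛ₁ ⊆ M` is `u·Λ₁`, `u ∈ Kˣ`.
* §3 `zpow_theta_add_one_inj` (`(θ+1)^m = ±(θ+1)^{m'} ⟹ m = m'`, sign `+`), and the INDICES in the formula's spelling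
  (`Λ^{unit} = {u : Kˣ | u, u⁻¹ ∈ Λ}`, classes of `Λ₁^{unit}` modulo `Λᵢ^{unit}`): **`natCard_unitsIndex_span₂`** (`= 2`),
  **`natCard_unitsIndex_span₃`** (`= 4`), **`natCard_unitsIndex_span₄`** (`= 4`), via the exponent map
  `±(θ+1)^m ↦ m mod k` and `unit_spanᵢ_iff` (`…CubicFundamentalUnit`).

* §4 (row g43-#7) the conductors in coordinates `mem_C₂_iff`, `mem_C₃_iff`, `mem_C₄_iff` and the remaining factors,
  counted by residues of coordinates with the invertible residues DECIDED from `coords_mul`: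
  `natCard_unitsMod_span₁_C₂ = 2`, `natCard_unitsMod_span₂_C₂ = 1`, `natCard_unitsMod_span₁_C₃ = 4`,
  `natCard_unitsMod_span₃_C₃ = 1`, `natCard_unitsMod_span₁_C₄ = 32`, `natCard_unitsMod_span₄_C₄ = 4` (HL: «`|(Λ_1/C_2)^{unit}|
  = 2`, `|(Λ_2/C_2)^{unit}| = 1`, `|(Λ_1/C_3)^{unit}| = 4`, `|(Λ_3/C_3)^{unit}| = 1`, `|(Λ_1/C_4)^{unit}| = 32`, `|(Λ_4/C_4)^{unit}| = 4`»).
* §5 (row g43-#7) the values, by the tree's formula (5.22) `natCard_quot_pic_mul_mul_index_eq`: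
  **`natCard_pic_span₂_eq_one`**, **`natCard_pic_span₃_eq_one`**, **`natCard_pic_span₄_eq_two`** (HL: «`|G([Λ_2]_ε)| = 1`,
  `|G([Λ_3]_ε)| = 1`, `|G([Λ_4]_ε)| = ¼ · 32/4 = 2`»; with `smul_span₄_ne_spanL₄` of `…CubicUnits`,
  «`G([Λ_4]_ε) = {[Λ_4]_ε, [L_4]_ε}`»).
* §6 (row g43-#8) `span₁/₂/₄_eq_toSubmodule_adjoin` (`Λ₁ = ℤ[θ]`, `Λ₂ = ℤ[θ²]`, `Λ₄ = ℤ[2θ]` are CYCLIC orders),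
  `mul_div_div_eq_of_div_self_eq_cyclic` (HL Thm. 4.12, the tree's `mul_div_eq_of_div_self_eq_adjoin`: every full lattice
  with one of these orders is invertible), `natCard_quot_weak_eq_one_of_forall_invertible` (`τ = 1`), and the numbers of
  ALL `ε`-classes over them, **`natCard_quot_span₁_eq_one`**, **`natCard_quot_span₂_eq_one`**, **`natCard_quot_span₄_eq_two`**
  (HL: «`τ_1 = τ_4 = 1` by Theorem 4.12», «`τ_2 = 1`»; via the tree's Thm. 1.3 (b) count
  `natCard_quot_div_self_eq_eq_of_natCard_quot_weak_eq_one`).  Not here: `τ_3 = 2` (Faddeev's Theorem 5.7).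

## References
* [HL26b] C. Hertling, K. Larabi, arXiv:2602.15748 (2026), §8 (chunks p0024–p0025), §5 Thm. 5.12 (e).
  [HertlingLarabi2026b]
* [HL26] C. Hertling, K. Larabi, arXiv:2602.14973 (2026), §6 Thm. 6.1 (c) (`G([Λ_max]_ε)` is the class group).
  [HertlingLarabi2026]
-/

noncomputable section

open scoped Pointwise
open Polynomial Module NumberField Submodule

namespace Literature.NumberTheory.ComplexMultiplication.FiniteQAlgebraLattice.DTZCubic

open Literature.NumberTheory.NumberFields
open Literature.NumberTheory.Automorphic (IsFullLattice)

variable {K : Type} [Field K] [NumberField K] {θ : K}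

/-! ## §1 `Λ₁ = Λ_max` and the four orders are full lattices -/

/-- **`Λ₁ = ⟨1, θ, θ²⟩_ℤ` is the `ℤ`-submodule `Λ_max` of algebraic integers of `K`** (`𝓞_K = ℤ[θ]`).
[cite: HertlingLarabi2026b, §8 («`Λ_1 := Λ_max = ℤ[β] = ⟨1, β, β²⟩_ℤ`»), chunk p0024] -/
theorem span₁_eq_toSubmodule_integralClosure (hθ : aeval θ (MonicCubic.poly 2 2 2) = 0) (h3 : finrank ℚ K = 3) :
    span ℤ ({1, θ, θ ^ 2} : Set K) = Subalgebra.toSubmodule (integralClosure ℤ K) := by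
  refine le_antisymm (fun x hx => ?_) (fun x hx => ?_)
  · rw [mem_toSubmodule_integralClosure_iff]
    obtain ⟨hx1, -⟩ := (unit_span₁_iff hθ h3 (1 : K)).2 ⟨0, Or.inl (zpow_zero _).symm⟩
    -- integrality of the coordinates' combination
    obtain ⟨u, v, w, rfl⟩ := exists_coords_of_mem_span₁ hx
    have hθi : IsIntegral ℤ θ := MonicCubic.isIntegral_of_aeval hθ
    have hi : ∀ n : ℤ, IsIntegral ℤ (n : K) := fun n => by
      simpa using (isIntegral_algebraMap (R := ℤ) (A := K) (x := n))
    exact ((hi u).add ((hi v).mul hθi)).add ((hi w).mul (hθi.pow 2))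
  · exact mem_span₁_of_isIntegral hθ h3 ((mem_toSubmodule_integralClosure_iff K).1 hx)

/-- `Λ₁` is a full lattice of `K`. [cite: HertlingLarabi2026b, §8 («`Λ_1 := Λ_max`»), chunk p0024] -/
theorem isFullLattice_span₁ (hθ : aeval θ (MonicCubic.poly 2 2 2) = 0) (h3 : finrank ℚ K = 3) :
    IsFullLattice K (span ℤ ({1, θ, θ ^ 2} : Set K)) := by
  rw [span₁_eq_toSubmodule_integralClosure hθ h3]
  exact isFullLattice_toSubmodule_integralClosure K

omit [NumberField K] in
/-- A finitely generated lattice containing `4Λ` for a full lattice `Λ` is full. [folklore] -/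
private theorem isFullLattice_of_four_smul_le {Λ Λ' : Submodule ℤ K} (hΛ : IsFullLattice K Λ) (hfg : Λ'.FG)
    (h4 : ∀ x ∈ Λ, (4 : ℤ) • x ∈ Λ') : IsFullLattice K Λ' := by
  refine ⟨hfg, fun d => ?_⟩
  obtain ⟨n, hn, hnd⟩ := hΛ.2 d
  refine ⟨4 * n, mul_ne_zero (by norm_num) hn, ?_⟩
  rw [mul_smul]
  exact h4 _ hnd

omit [NumberField K] in
/-- `4Λ₁ ⊆ Λ₄`. [cite: HertlingLarabi2026b, §8 («`C_4 = ⟨4, 4β, 4β²⟩`»), chunk p0025] -/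
private theorem four_smul_mem_span₄ (hli : LinearIndependent ℤ ![(1 : K), θ, θ ^ 2]) {x : K}
    (hx : x ∈ span ℤ ({1, θ, θ ^ 2} : Set K)) : (4 : ℤ) • x ∈ span ℤ ({1, 2 * θ, 4 * θ ^ 2} : Set K) := by
  obtain ⟨u, v, w, rfl⟩ := exists_coords_of_mem_span₁ hx
  rw [show (4 : ℤ) • ((u : K) + v * θ + w * θ ^ 2) = ((4 * u : ℤ) : K) + ((4 * v : ℤ) : K) * θ + ((4 * w : ℤ) : K) * θ ^ 2
    by push_cast; simp only [zsmul_eq_mul]; push_cast; ring, mem_span₄_iff hli]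
  exact ⟨⟨2 * v, by ring⟩, ⟨w, rfl⟩⟩

/-- `Λ₄ = ⟨1, 2θ, 4θ²⟩` is a full lattice. [cite: HertlingLarabi2026b, §8 («`Λ_4 = ℤ[2β] = ⟨1, 2β, 4β²⟩_ℤ`»), chunk p0024] -/
theorem isFullLattice_span₄ (hθ : aeval θ (MonicCubic.poly 2 2 2) = 0) (h3 : finrank ℚ K = 3) :
    IsFullLattice K (span ℤ ({1, 2 * θ, 4 * θ ^ 2} : Set K)) :=
  isFullLattice_of_four_smul_le (isFullLattice_span₁ hθ h3) (fg_span ((Set.toFinite _)))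
    fun _ hx => four_smul_mem_span₄ (linearIndependent_one_theta_sq hθ h3) hx

/-- `Λ₃ = ⟨1, 2θ, 2θ²⟩` is a full lattice. [cite: HertlingLarabi2026b, §8 Lemma 8.1 («`Λ_3 = ⟨1, 2β, 2β²⟩_ℤ`»), chunk p0024] -/
theorem isFullLattice_span₃ (hθ : aeval θ (MonicCubic.poly 2 2 2) = 0) (h3 : finrank ℚ K = 3) :
    IsFullLattice K (span ℤ ({1, 2 * θ, 2 * θ ^ 2} : Set K)) :=
  isFullLattice_of_four_smul_le (isFullLattice_span₁ hθ h3) (fg_span ((Set.toFinite _)))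
    fun _ hx => span₄_le_span₃ θ (four_smul_mem_span₄ (linearIndependent_one_theta_sq hθ h3) hx)

/-- `Λ₂ = ⟨1, 2θ, θ²⟩` is a full lattice. [cite: HertlingLarabi2026b, §8 Lemma 8.1 («`Λ_2 = ⟨1, 2β, β²⟩_ℤ`»), chunk p0024] -/
theorem isFullLattice_span₂ (hθ : aeval θ (MonicCubic.poly 2 2 2) = 0) (h3 : finrank ℚ K = 3) :
    IsFullLattice K (span ℤ ({1, 2 * θ, θ ^ 2} : Set K)) :=
  isFullLattice_of_four_smul_le (isFullLattice_span₁ hθ h3) (fg_span ((Set.toFinite _)))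
    fun _ hx => span₃_le_span₂ θ (span₄_le_span₃ θ (four_smul_mem_span₄ (linearIndependent_one_theta_sq hθ h3) hx))

/-! ## §2 `|G([Λ₁]_ε)| = 1` (class number one) -/

omit [NumberField K] in
/-- `ε`-class counts only depend on the defining property of the lattices up to equivalence. [folklore] -/
private theorem natCard_quot_congr {P P' : Submodule ℤ K → Prop} (h : ∀ M, P M ↔ P' M) :
    Nat.card (Quot fun M M' : {M : Submodule ℤ K // P M} => ∃ u : Kˣ, u • M.1 = M'.1) =
      Nat.card (Quot fun M M' : {M : Submodule ℤ K // P' M} => ∃ u : Kˣ, u • M.1 = M'.1) := by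
  obtain rfl : P = P' := funext fun M => propext (h M)
  rfl

/-- For a full lattice `M` of the field `K`: `𝒪(M) = Λ₁` and `M` invertible iff `MΛ_max ⊆ M` (HL 2026 Thm. 6.1 (b):
every full lattice with `𝒪(L) = Λ_max` is invertible). [cite: HertlingLarabi2026, §6 Thm. 6.1 (b), chunk p0015] -/
theorem pic_span₁_iff (hθ : aeval θ (MonicCubic.poly 2 2 2) = 0) (h3 : finrank ℚ K = 3) (M : Submodule ℤ K) :
    (IsFullLattice K M ∧ M / M = span ℤ ({1, θ, θ ^ 2} : Set K) ∧ M * ((M / M) / M) = M / M) ↔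
      (IsFullLattice K M ∧ ∀ m ∈ M, ∀ a ∈ Subalgebra.toSubmodule (integralClosure ℤ K), m * a ∈ M) := by
  rw [span₁_eq_toSubmodule_integralClosure hθ h3]
  constructor
  · rintro ⟨hM, hO, -⟩
    refine ⟨hM, fun m hm a ha => ?_⟩
    rw [← hO] at ha
    rw [mul_comm]
    exact Submodule.mem_div_iff_forall_mul_mem.1 ha m hm
  · rintro ⟨hM, h⟩
    exact ⟨hM, mul_div_eq_of_forall_mul_mem_integralClosure hM h⟩

/-- **`|G([Λ₁]_ε)| = |G([Λ_max]_ε)| = (class number of `K`) = 1`**: the `ε`-classes (orbits under `Kˣ`) of invertible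
full lattices `M` with `𝒪(M) = Λ₁` number one — HL's first factor, cited by them from [LMFDB23], PROVED
(`classNumber_eq_one` and HL 2026 Thm. 6.1 (c), `natCard_quot_isFullLattice_eq_classNumber`).
[cite: HertlingLarabi2026b, §8 («`|G([Λ_max]_ε)| = (class number of A) = 1`»), chunk p0024] -/
theorem natCard_pic_span₁_eq_one (hθ : aeval θ (MonicCubic.poly 2 2 2) = 0) (h3 : finrank ℚ K = 3) :
    Nat.card (Quot fun M M' : {M : Submodule ℤ K //
        IsFullLattice K M ∧ M / M = span ℤ ({1, θ, θ ^ 2} : Set K) ∧ M * ((M / M) / M) = M / M} =>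
      ∃ u : Kˣ, u • M.1 = M'.1) = 1 := by
  rw [natCard_quot_congr (pic_span₁_iff hθ h3), ← classNumber_eq_one hθ h3]
  exact natCard_quot_isFullLattice_eq_classNumber K

omit [NumberField K] in
/-- The relation `∃ u : Kˣ, u • M = M'` is an equivalence relation on any set of lattices. [folklore] -/
private theorem equivalence_units_smul (P : Submodule ℤ K → Prop) :
    Equivalence fun M M' : {M : Submodule ℤ K // P M} => ∃ u : Kˣ, u • M.1 = M'.1 where
  refl M := ⟨1, one_smul _ _⟩
  symm := by
    rintro M M' ⟨u, hu⟩
    exact ⟨u⁻¹, by rw [← hu, inv_smul_smul]⟩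
  trans := by
    rintro M M' M'' ⟨u, hu⟩ ⟨v, hv⟩
    exact ⟨v * u, by rw [mul_smul, hu, hv]⟩

/-- **Class number one, lattice form: every full lattice `M ⊂ K` with `MΛ₁ ⊆ M` is principal, `M = u·Λ₁` with
`u ∈ Kˣ`.** [cite: HertlingLarabi2026b, §8 («`|G([Λ_max]_ε)| = (class number of A) = 1`»), chunk p0024] -/
theorem exists_units_smul_span₁_eq (hθ : aeval θ (MonicCubic.poly 2 2 2) = 0) (h3 : finrank ℚ K = 3)
    {M : Submodule ℤ K} (hM : IsFullLattice K M)
    (hmul : ∀ m ∈ M, ∀ a ∈ span ℤ ({1, θ, θ ^ 2} : Set K), m * a ∈ M) :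
    ∃ u : Kˣ, u • span ℤ ({1, θ, θ ^ 2} : Set K) = M := by
  have hβ := theta_rel_two hθ
  -- both `M` and `Λ₁` lie in the one-element class set
  let P : Submodule ℤ K → Prop := fun M =>
    IsFullLattice K M ∧ M / M = span ℤ ({1, θ, θ ^ 2} : Set K) ∧ M * ((M / M) / M) = M / M
  have hPM : P M := by
    refine (pic_span₁_iff hθ h3 M).2 ⟨hM, fun m hm a ha => hmul m hm a ?_⟩
    rwa [span₁_eq_toSubmodule_integralClosure hθ h3]
  have hP1 : P (span ℤ ({1, θ, θ ^ 2} : Set K)) := by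
    refine (pic_span₁_iff hθ h3 _).2 ⟨isFullLattice_span₁ hθ h3, fun m hm a ha => ?_⟩
    rw [← span₁_eq_toSubmodule_integralClosure hθ h3] at ha
    exact span₁_mul_le hβ (mul_mem_mul hm ha)
  have hcard := natCard_pic_span₁_eq_one hθ h3
  haveI : Finite (Quot fun M M' : {M : Submodule ℤ K // P M} => ∃ u : Kˣ, u • M.1 = M'.1) :=
    Nat.finite_of_card_ne_zero (by rw [hcard]; exact one_ne_zero)
  have hsub := (Nat.card_eq_one_iff_unique.1 hcard).1
  have heq : Quot.mk (fun M M' : {M : Submodule ℤ K // P M} => ∃ u : Kˣ, u • M.1 = M'.1) ⟨_, hP1⟩ =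
      Quot.mk _ ⟨M, hPM⟩ := Subsingleton.elim _ _
  obtain ⟨u, hu⟩ := ((equivalence_units_smul P).eqvGen_iff).1 (Quot.eqvGen_exact heq)
  exact ⟨u, hu⟩

/-! ## §3 The unit indices `[Λ₁^{unit} : Λᵢ^{unit}]` -/

/-- **Exponents of `θ + 1` are unique**: `(θ+1)^m = (θ+1)^{m'}` or `(θ+1)^m = −(θ+1)^{m'}` forces `m = m'` and the sign `+`
(`|σ(θ+1)| ∈ (0, 1)` under the real embedding, so `θ + 1` is no root of unity). [cite: HertlingLarabi2026b, §8 («`Λ_1^{unit} = {±(β+1)^l | l ∈ ℤ}`»), chunk p0025] -/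
theorem zpow_theta_add_one_inj (hθ : aeval θ (MonicCubic.poly 2 2 2) = 0) (h3 : finrank ℚ K = 3) {m m' : ℤ}
    (h : (θ + 1) ^ m = (θ + 1) ^ m' ∨ (θ + 1) ^ m = -(θ + 1) ^ m') :
    m = m' ∧ (θ + 1) ^ m = (θ + 1) ^ m' := by
  classical
  have hodd : Odd (finrank ℚ K) := by rw [h3]; decide
  obtain ⟨w⟩ := Fintype.card_pos_iff.mp (InfinitePlace.nrRealPlaces_pos_of_odd_finrank hodd)
  let σ : K →+* ℝ := InfinitePlace.embedding_of_isReal w.2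
  -- `σ(θ + 1) ∈ (−3/5, −1/2)`
  have hrel := congrArg σ (theta_rel_two hθ)
  rw [map_add, map_add, map_add, map_mul, map_mul, map_pow, map_pow, map_zero] at hrel
  have h2 : σ (2 : K) = 2 := map_ofNat σ 2
  rw [h2] at hrel
  have hlt : σ θ < -3 / 2 := by
    refine lt_of_not_ge fun hle => ?_
    have hq : 0 ≤ (σ θ + 1 / 4) ^ 2 + 19 / 16 := by positivity
    nlinarith [mul_nonneg (by linarith : 0 ≤ σ θ + 3 / 2) hq]
  have hgt : -8 / 5 < σ θ := by
    refine lt_of_not_ge fun hle => ?_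
    have hq : 0 ≤ (σ θ + 1 / 5) ^ 2 + 33 / 25 := by positivity
    nlinarith [mul_nonneg (neg_nonneg.2 (by linarith : σ θ + 8 / 5 ≤ 0)) hq]
  have ha0 : 0 < |σ (θ + 1)| := by rw [map_add, map_one, abs_of_neg (by linarith)]; linarith
  have ha1 : |σ (θ + 1)| ≠ 1 := by rw [map_add, map_one, abs_of_neg (by linarith)]; linarith
  have hinj := zpow_right_injective₀ ha0 ha1
  have hmm : m = m' := by
    apply hinj
    dsimp only
    rcases h with h | h
    · have h' := congrArg (fun x => |σ x|) h
      simpa only [map_zpow₀, abs_zpow] using h'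
    · have h' := congrArg (fun x => |σ x|) h
      simpa only [map_neg, map_zpow₀, abs_neg, abs_zpow] using h'
  subst hmm
  refine ⟨rfl, ?_⟩
  rfl

/-- The sign is `+`: `(θ+1)^m ≠ −(θ+1)^{m'}`. [cite: HertlingLarabi2026b, §8 («`Λ_1^{unit} = {±(β+1)^l | l ∈ ℤ}`»), chunk p0025] -/
theorem zpow_theta_add_one_ne_neg (hθ : aeval θ (MonicCubic.poly 2 2 2) = 0) (h3 : finrank ℚ K = 3) (m m' : ℤ) :
    (θ + 1) ^ m ≠ -(θ + 1) ^ m' := by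
  intro h
  obtain ⟨rfl, -⟩ := zpow_theta_add_one_inj hθ h3 (Or.inr h)
  have hne : (θ + 1) ^ m ≠ 0 :=
    zpow_ne_zero m (left_ne_zero_of_mul_eq_one (add_one_mul_eq_one (theta_rel_two hθ)))
  exact hne (by linear_combination h / 2)

/-- **The index `[Λ₁^{unit} : Λ^{unit}]` of a sub-order whose units are `±(θ+1)^{kℤ}` is `k`** (classes of
`Λ₁^{unit} = ±(θ+1)^ℤ` modulo `Λ^{unit}`, counted by `m mod k`). [cite: HertlingLarabi2026b, §8 («`[Λ_1^{unit} : Λ_2^{unit}] = 2`, `[Λ_1^{unit} : Λ_3^{unit}] = [Λ_1^{unit} : Λ_4^{unit}] = 4`»), chunk p0025] -/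
theorem natCard_unitsIndex_eq (hθ : aeval θ (MonicCubic.poly 2 2 2) = 0) (h3 : finrank ℚ K = 3)
    {Λ : Submodule ℤ K} {k : ℕ} [NeZero k]
    (hΛ : ∀ c : K, (c ∈ Λ ∧ ∃ x ∈ Λ, c * x = 1) ↔ ∃ m : ℤ, (k : ℤ) ∣ m ∧ (c = (θ + 1) ^ m ∨ c = -(θ + 1) ^ m)) :
    Nat.card (Quot fun u v : {u : Kˣ // (u : K) ∈ span ℤ ({1, θ, θ ^ 2} : Set K) ∧
        ((u⁻¹ : Kˣ) : K) ∈ span ℤ ({1, θ, θ ^ 2} : Set K)} =>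
      ∃ w : Kˣ, (w : K) ∈ Λ ∧ ((w⁻¹ : Kˣ) : K) ∈ Λ ∧ (v.1 : Kˣ) = u.1 * w) = k := by
  have hne1 : (θ + 1) ≠ 0 := left_ne_zero_of_mul_eq_one (add_one_mul_eq_one (theta_rel_two hθ))
  -- every unit of `Λ₁` has a unique exponent
  have hex : ∀ u : {u : Kˣ // (u : K) ∈ span ℤ ({1, θ, θ ^ 2} : Set K) ∧
      ((u⁻¹ : Kˣ) : K) ∈ span ℤ ({1, θ, θ ^ 2} : Set K)},
      ∃ m : ℤ, (u.1 : K) = (θ + 1) ^ m ∨ (u.1 : K) = -(θ + 1) ^ m := fun u =>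
    (unit_span₁_iff hθ h3 (u.1 : K)).1 ⟨u.2.1, _, u.2.2, u.1.mul_inv⟩
  choose e he using hex
  -- uniqueness of the exponent, up to sign
  have huniq : ∀ {c : K} {m m' : ℤ}, (c = (θ + 1) ^ m ∨ c = -(θ + 1) ^ m) →
      (c = (θ + 1) ^ m' ∨ c = -(θ + 1) ^ m') → m = m' := by
    intro c m m' h h'
    rcases h with rfl | rfl <;> rcases h' with h' | h'
    · exact (zpow_theta_add_one_inj hθ h3 (Or.inl h')).1
    · exact (zpow_theta_add_one_inj hθ h3 (Or.inr h')).1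
    · exact absurd h'.symm (zpow_theta_add_one_ne_neg hθ h3 m' m)
    · exact (zpow_theta_add_one_inj hθ h3 (Or.inl (neg_injective h'))).1
  -- the quotient `u⁻¹ v` of two units with exponents `m, m'` is `±(θ+1)^(m' − m)`
  have hquot : ∀ u v : {u : Kˣ // (u : K) ∈ span ℤ ({1, θ, θ ^ 2} : Set K) ∧
      ((u⁻¹ : Kˣ) : K) ∈ span ℤ ({1, θ, θ ^ 2} : Set K)},
      ((u.1⁻¹ * v.1 : Kˣ) : K) = (θ + 1) ^ (e v - e u) ∨ ((u.1⁻¹ * v.1 : Kˣ) : K) = -(θ + 1) ^ (e v - e u) := by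
    intro u v
    have hu0 : (θ + 1) ^ e u ≠ 0 := zpow_ne_zero _ hne1
    rw [Units.val_mul, Units.val_inv_eq_inv_val, zpow_sub₀ hne1, div_eq_mul_inv, mul_comm ((θ + 1) ^ e v)]
    rcases he u with h | h <;> rcases he v with h' | h' <;> rw [h, h']
    · exact Or.inl rfl
    · exact Or.inr (by rw [mul_neg])
    · exact Or.inr (by rw [inv_neg, neg_mul])
    · exact Or.inl (by rw [inv_neg, neg_mul_neg])
  -- the exponent map to `ZMod k`
  let E : Quot (fun u v : {u : Kˣ // (u : K) ∈ span ℤ ({1, θ, θ ^ 2} : Set K) ∧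
        ((u⁻¹ : Kˣ) : K) ∈ span ℤ ({1, θ, θ ^ 2} : Set K)} =>
      ∃ w : Kˣ, (w : K) ∈ Λ ∧ ((w⁻¹ : Kˣ) : K) ∈ Λ ∧ (v.1 : Kˣ) = u.1 * w) → ZMod k :=
    Quot.lift (fun u => ((e u : ℤ) : ZMod k)) (by
      rintro u v ⟨w, hw, hw', hvw⟩
      have hwq : w = u.1⁻¹ * v.1 := by rw [hvw, inv_mul_cancel_left]
      obtain ⟨m, hkm, hm⟩ := (hΛ (w : K)).1 ⟨hw, _, hw', w.mul_inv⟩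
      rw [hwq] at hm
      have hmeq : m = e v - e u := huniq hm (hquot u v)
      rw [ZMod.intCast_eq_intCast_iff_dvd_sub, ← hmeq]
      exact hkm)
  have hE : Function.Bijective E := by
    constructor
    · rintro ⟨u⟩ ⟨v⟩ hEq
      change ((e u : ℤ) : ZMod k) = ((e v : ℤ) : ZMod k) at hEq
      rw [ZMod.intCast_eq_intCast_iff_dvd_sub] at hEq
      apply Quot.sound
      obtain ⟨hw, x, hx, hwx⟩ := (hΛ ((u.1⁻¹ * v.1 : Kˣ) : K)).2 ⟨e v - e u, hEq, hquot u v⟩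
      refine ⟨u.1⁻¹ * v.1, hw, ?_, by rw [mul_inv_cancel_left]⟩
      have hxe : x = (((u.1⁻¹ * v.1)⁻¹ : Kˣ) : K) := by
        rw [Units.val_inv_eq_inv_val]; exact (eq_inv_of_mul_eq_one_right hwx)
      rw [← hxe]; exact hx
    · intro r
      have hr0 : (θ + 1) ^ (r.cast : ℤ) ≠ 0 := zpow_ne_zero _ hne1
      obtain ⟨hm1, y, hy1, hy⟩ := (unit_span₁_iff hθ h3 ((θ + 1) ^ (r.cast : ℤ))).2 ⟨_, Or.inl rfl⟩
      let u : {u : Kˣ // (u : K) ∈ span ℤ ({1, θ, θ ^ 2} : Set K) ∧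
          ((u⁻¹ : Kˣ) : K) ∈ span ℤ ({1, θ, θ ^ 2} : Set K)} :=
        ⟨Units.mk0 _ hr0, hm1, by
          rw [Units.val_inv_eq_inv_val, Units.val_mk0, ← eq_inv_of_mul_eq_one_right hy]; exact hy1⟩
      refine ⟨Quot.mk _ u, ?_⟩
      change ((e u : ℤ) : ZMod k) = r
      have heu : e u = (r.cast : ℤ) := huniq (he u) (Or.inl (Units.val_mk0 hr0))
      rw [heu, ZMod.intCast_zmod_cast]
  rw [Nat.card_eq_of_bijective E hE, Nat.card_zmod]

/-- **`[Λ₁^{unit} : Λ₂^{unit}] = 2`.** [cite: HertlingLarabi2026b, §8 («`[Λ_1^{unit} : Λ_2^{unit}] = 2`»), chunk p0025] -/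
theorem natCard_unitsIndex_span₂ (hθ : aeval θ (MonicCubic.poly 2 2 2) = 0) (h3 : finrank ℚ K = 3) :
    Nat.card (Quot fun u v : {u : Kˣ // (u : K) ∈ span ℤ ({1, θ, θ ^ 2} : Set K) ∧
        ((u⁻¹ : Kˣ) : K) ∈ span ℤ ({1, θ, θ ^ 2} : Set K)} =>
      ∃ w : Kˣ, (w : K) ∈ span ℤ ({1, 2 * θ, θ ^ 2} : Set K) ∧
        ((w⁻¹ : Kˣ) : K) ∈ span ℤ ({1, 2 * θ, θ ^ 2} : Set K) ∧ (v.1 : Kˣ) = u.1 * w) = 2 :=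
  natCard_unitsIndex_eq hθ h3 (k := 2) fun c => by simpa using unit_span₂_iff hθ h3 c

/-- **`[Λ₁^{unit} : Λ₃^{unit}] = 4`.** [cite: HertlingLarabi2026b, §8 («`[Λ_1^{unit} : Λ_3^{unit}] = 4`»), chunk p0025] -/
theorem natCard_unitsIndex_span₃ (hθ : aeval θ (MonicCubic.poly 2 2 2) = 0) (h3 : finrank ℚ K = 3) :
    Nat.card (Quot fun u v : {u : Kˣ // (u : K) ∈ span ℤ ({1, θ, θ ^ 2} : Set K) ∧
        ((u⁻¹ : Kˣ) : K) ∈ span ℤ ({1, θ, θ ^ 2} : Set K)} =>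
      ∃ w : Kˣ, (w : K) ∈ span ℤ ({1, 2 * θ, 2 * θ ^ 2} : Set K) ∧
        ((w⁻¹ : Kˣ) : K) ∈ span ℤ ({1, 2 * θ, 2 * θ ^ 2} : Set K) ∧ (v.1 : Kˣ) = u.1 * w) = 4 :=
  natCard_unitsIndex_eq hθ h3 (k := 4) fun c => by simpa using unit_span₃_iff hθ h3 c

/-- **`[Λ₁^{unit} : Λ₄^{unit}] = 4`.** [cite: HertlingLarabi2026b, §8 («`[Λ_1^{unit} : Λ_4^{unit}] = 4`»), chunk p0025] -/
theorem natCard_unitsIndex_span₄ (hθ : aeval θ (MonicCubic.poly 2 2 2) = 0) (h3 : finrank ℚ K = 3) :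
    Nat.card (Quot fun u v : {u : Kˣ // (u : K) ∈ span ℤ ({1, θ, θ ^ 2} : Set K) ∧
        ((u⁻¹ : Kˣ) : K) ∈ span ℤ ({1, θ, θ ^ 2} : Set K)} =>
      ∃ w : Kˣ, (w : K) ∈ span ℤ ({1, 2 * θ, 4 * θ ^ 2} : Set K) ∧
        ((w⁻¹ : Kˣ) : K) ∈ span ℤ ({1, 2 * θ, 4 * θ ^ 2} : Set K) ∧ (v.1 : Kˣ) = u.1 * w) = 4 :=
  natCard_unitsIndex_eq hθ h3 (k := 4) fun c => by simpa using unit_span₄_iff hθ h3 c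

/-! ## §4 The conductors in coordinates and the finite unit groups `(Λ/C)^{unit}` (HL §8, chunk p0025)

HL: «`C_2 = ⟨2, 2β, β²⟩_ℤ`, `(Λ_2/C_2)^{unit} ≅ {[1]}`, `|(Λ_2/C_2)^{unit}| = 1`, `(Λ_1/C_2)^{unit} = {[1], [1+β]}`,
`|(Λ_1/C_2)^{unit}| = 2`.  `C_3 = ⟨2, 2β, 2β²⟩_ℤ = 2Λ_1`, `|(Λ_3/C_3)^{unit}| = 1`, `|(Λ_1/C_3)^{unit}| = 4`.
`C_4 = ⟨4, 4β, 4β²⟩_ℤ = 4Λ_1`, `|(Λ_4/C_4)^{unit}| = 4`, `|(Λ_1/C_4)^{unit}| = 32`.»  In the formula's spelling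
`(Λ/C)^{unit}` is the `Quot` of `{a ∈ Λ | ∃ a' ∈ Λ, aa' − 1 ∈ C}` by `a − b ∈ C`; each count is a bijection with the
residues of the coordinates `(u, v, w)` of `a = u + vθ + wθ²` modulo `2` or `4`, the invertible residues being found by
`decide` from the product formula `coords_mul`. -/

omit [NumberField K] in
/-- Coefficient comparison in `Λ₁`. [folklore] -/
private theorem coeff_eq_zero' (hli : LinearIndependent ℤ ![(1 : K), θ, θ ^ 2]) {a b c : ℤ}
    (h : (a : K) + b * θ + c * θ ^ 2 = 0) : a = 0 ∧ b = 0 ∧ c = 0 := by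
  have H := Fintype.linearIndependent_iff.1 hli ![a, b, c] (by
    simpa [Fin.sum_univ_three, zsmul_eq_mul] using h)
  exact ⟨by simpa using H 0, by simpa using H 1, by simpa using H 2⟩

omit [NumberField K] in
/-- Integer combinations of `1, θ, θ²` lie in `Λ₁`. [folklore] -/
private theorem coords_mem_span₁ (u v w : ℤ) : (u : K) + v * θ + w * θ ^ 2 ∈ span ℤ ({1, θ, θ ^ 2} : Set K) :=
  mem_span_triple.2 ⟨u, v, w, by simp only [zsmul_eq_mul, mul_one]⟩

omit [NumberField K] in
/-- **`u + vθ + wθ² ∈ C_2 = ⟨2, 2θ, θ²⟩ ⟺ 2 ∣ u ∧ 2 ∣ v`.** [cite: HertlingLarabi2026b, §8 («`C_2 = ⟨2, 2β, β²⟩_ℤ`»), chunk p0025] -/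
theorem mem_C₂_iff (hli : LinearIndependent ℤ ![(1 : K), θ, θ ^ 2]) (u v w : ℤ) :
    (u : K) + v * θ + w * θ ^ 2 ∈ span ℤ ({2, 2 * θ, θ ^ 2} : Set K) ↔ 2 ∣ u ∧ 2 ∣ v := by
  constructor
  · intro h
    obtain ⟨a, b, c, habc⟩ := mem_span_triple.1 h
    simp only [zsmul_eq_mul] at habc
    obtain ⟨h1, h2, -⟩ := coeff_eq_zero' hli (a := 2 * a - u) (b := 2 * b - v) (c := c - w)
      (by push_cast; linear_combination habc)
    exact ⟨⟨a, by omega⟩, ⟨b, by omega⟩⟩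
  · rintro ⟨⟨k, rfl⟩, ⟨m, rfl⟩⟩
    exact mem_span_triple.2 ⟨k, m, w, by simp only [zsmul_eq_mul]; push_cast; ring⟩

omit [NumberField K] in
/-- **`u + vθ + wθ² ∈ C_3 = ⟨2, 2θ, 2θ²⟩ ⟺ 2 ∣ u, v, w`.** [cite: HertlingLarabi2026b, §8 («`C_3 = ⟨2, 2β, 2β²⟩_ℤ`»), chunk p0025] -/
theorem mem_C₃_iff (hli : LinearIndependent ℤ ![(1 : K), θ, θ ^ 2]) (u v w : ℤ) :
    (u : K) + v * θ + w * θ ^ 2 ∈ span ℤ ({2, 2 * θ, 2 * θ ^ 2} : Set K) ↔ 2 ∣ u ∧ 2 ∣ v ∧ 2 ∣ w := by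
  constructor
  · intro h
    obtain ⟨a, b, c, habc⟩ := mem_span_triple.1 h
    simp only [zsmul_eq_mul] at habc
    obtain ⟨h1, h2, h3⟩ := coeff_eq_zero' hli (a := 2 * a - u) (b := 2 * b - v) (c := 2 * c - w)
      (by push_cast; linear_combination habc)
    exact ⟨⟨a, by omega⟩, ⟨b, by omega⟩, ⟨c, by omega⟩⟩
  · rintro ⟨⟨k, rfl⟩, ⟨m, rfl⟩, ⟨l, rfl⟩⟩
    exact mem_span_triple.2 ⟨k, m, l, by simp only [zsmul_eq_mul]; push_cast; ring⟩

omit [NumberField K] in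
/-- **`u + vθ + wθ² ∈ C_4 = ⟨4, 4θ, 4θ²⟩ ⟺ 4 ∣ u, v, w`.** [cite: HertlingLarabi2026b, §8 («`C_4 = ⟨4, 4β, 4β²⟩_ℤ`»), chunk p0025] -/
theorem mem_C₄_iff (hli : LinearIndependent ℤ ![(1 : K), θ, θ ^ 2]) (u v w : ℤ) :
    (u : K) + v * θ + w * θ ^ 2 ∈ span ℤ ({4, 4 * θ, 4 * θ ^ 2} : Set K) ↔ 4 ∣ u ∧ 4 ∣ v ∧ 4 ∣ w := by
  constructor
  · intro h
    obtain ⟨a, b, c, habc⟩ := mem_span_triple.1 h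
    simp only [zsmul_eq_mul] at habc
    obtain ⟨h1, h2, h3⟩ := coeff_eq_zero' hli (a := 4 * a - u) (b := 4 * b - v) (c := 4 * c - w)
      (by push_cast; linear_combination habc)
    exact ⟨⟨a, by omega⟩, ⟨b, by omega⟩, ⟨c, by omega⟩⟩
  · rintro ⟨⟨k, rfl⟩, ⟨m, rfl⟩, ⟨l, rfl⟩⟩
    exact mem_span_triple.2 ⟨k, m, l, by simp only [zsmul_eq_mul]; push_cast; ring⟩

omit [NumberField K] in
/-- Counting `(Λ/C)^{unit}` through representatives: if `rep : T → K` hits every class of invertible elements of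
`Λ` modulo `C` exactly once on `{t | p t}`, the count is `#{t | p t}`. [folklore] -/
private theorem natCard_unitsMod_eq_card {Λ C : Submodule ℤ K} {T : Type} [Fintype T] (p : T → Prop)
    [DecidablePred p] (rep : T → K)
    (hmem : ∀ t, p t → rep t ∈ Λ ∧ ∃ a' ∈ Λ, rep t * a' - 1 ∈ C)
    (hinj : ∀ t t', p t → p t' → rep t - rep t' ∈ C → t = t')
    (hsurj : ∀ a ∈ Λ, (∃ a' ∈ Λ, a * a' - 1 ∈ C) → ∃ t, p t ∧ rep t - a ∈ C) :
    Nat.card (Quot fun a b : {a : K // a ∈ Λ ∧ ∃ a' ∈ Λ, a * a' - 1 ∈ C} => a.1 - b.1 ∈ C) =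
      Fintype.card {t // p t} := by
  have hequiv : Equivalence fun a b : {a : K // a ∈ Λ ∧ ∃ a' ∈ Λ, a * a' - 1 ∈ C} => a.1 - b.1 ∈ C :=
    { refl := fun a => by rw [sub_self]; exact C.zero_mem
      symm := fun {a b} h => by rw [← neg_sub]; exact C.neg_mem h
      trans := fun {a b c} h h' => by rw [← sub_add_sub_cancel]; exact C.add_mem h h' }
  let G : {t // p t} → Quot (fun a b : {a : K // a ∈ Λ ∧ ∃ a' ∈ Λ, a * a' - 1 ∈ C} => a.1 - b.1 ∈ C) :=
    fun t => Quot.mk _ ⟨rep t.1, hmem t.1 t.2⟩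
  have hG : Function.Bijective G := by
    constructor
    · intro t t' h
      exact Subtype.ext (hinj _ _ t.2 t'.2 ((hequiv.eqvGen_iff).1 (Quot.eqvGen_exact h)))
    · rintro ⟨a⟩
      obtain ⟨t, ht, hta⟩ := hsurj a.1 a.2.1 a.2.2
      exact ⟨⟨t, ht⟩, Quot.sound hta⟩
  rw [← Nat.card_eq_of_bijective G hG, Nat.card_eq_fintype_card]

omit [NumberField K] in
/-- The product of two elements of `Λ₁` minus one, in coordinates (`coords_mul`). [folklore] -/
private theorem coords_mul_sub_one (hθ : aeval θ (MonicCubic.poly 2 2 2) = 0) (u v w u' v' w' : ℤ) :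
    ((u : K) + v * θ + w * θ ^ 2) * ((u' : K) + v' * θ + w' * θ ^ 2) - 1 =
      ((u * u' - 2 * (v * w' + w * v') + 4 * w * w' - 1 : ℤ) : K) +
        ((u * v' + v * u' - 2 * (v * w' + w * v') + 2 * w * w' : ℤ) : K) * θ +
        ((u * w' + v * v' + w * u' - 2 * (v * w' + w * v') + 2 * w * w' : ℤ) : K) * θ ^ 2 := by
  rw [coords_mul hθ]
  push_cast
  ring

omit [NumberField K] in
/-- The residue of `((z mod n) lifted to ℕ)` is `z` again. [folklore] -/
private theorem dvd_val_sub {n : ℕ} [NeZero n] (z : ℤ) : (n : ℤ) ∣ (((z : ZMod n).val : ℕ) : ℤ) - z := by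
  rw [ZMod.val_intCast]
  exact ⟨-(z / n), by rw [Int.emod_def]; ring⟩

omit [NumberField K] in
/-- **Counting `(Λ/nΛ₁)^{unit}` by residues mod `n`** for a lattice `C ⊆ Λ ⊆ Λ₁` whose membership, like that of
`C = nΛ₁`, is read off the coordinates mod `n`: the classes of invertible elements correspond to the residue triples
`t` with `p t`, where `p` is decided from the product formula. [folklore] -/
private theorem natCard_unitsMod_eq_card_coords (hθ : aeval θ (MonicCubic.poly 2 2 2) = 0)
    {n : ℕ} [NeZero n] {Λ C : Submodule ℤ K} (PΛ p : ZMod n × ZMod n × ZMod n → Prop) [DecidablePred p]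
    (hΛ : ∀ u v w : ℤ, (u : K) + v * θ + w * θ ^ 2 ∈ Λ ↔ PΛ ((u : ZMod n), (v : ZMod n), (w : ZMod n)))
    (hΛ₁ : Λ ≤ span ℤ ({1, θ, θ ^ 2} : Set K))
    (hC : ∀ u v w : ℤ, (u : K) + v * θ + w * θ ^ 2 ∈ C ↔ (n : ℤ) ∣ u ∧ (n : ℤ) ∣ v ∧ (n : ℤ) ∣ w)
    (hp : ∀ t, p t ↔ PΛ t ∧ ∃ t', PΛ t' ∧
      t.1 * t'.1 - 2 * (t.2.1 * t'.2.2 + t.2.2 * t'.2.1) + 4 * t.2.2 * t'.2.2 = 1 ∧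
      t.1 * t'.2.1 + t.2.1 * t'.1 - 2 * (t.2.1 * t'.2.2 + t.2.2 * t'.2.1) + 2 * t.2.2 * t'.2.2 = 0 ∧
      t.1 * t'.2.2 + t.2.1 * t'.2.1 + t.2.2 * t'.1 - 2 * (t.2.1 * t'.2.2 + t.2.2 * t'.2.1) + 2 * t.2.2 * t'.2.2 = 0) :
    Nat.card (Quot fun a b : {a : K // a ∈ Λ ∧ ∃ a' ∈ Λ, a * a' - 1 ∈ C} => a.1 - b.1 ∈ C) =
      Fintype.card {t // p t} := by
  have hdvd : ∀ z : ℤ, (n : ℤ) ∣ z ↔ ((z : ZMod n)) = 0 := fun z => (ZMod.intCast_zmod_eq_zero_iff_dvd z n).symm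
  refine natCard_unitsMod_eq_card p
    (fun t => (((t.1.val : ℕ) : ℤ) : K) + (((t.2.1.val : ℕ) : ℤ) : K) * θ + (((t.2.2.val : ℕ) : ℤ) : K) * θ ^ 2)
    ?_ ?_ ?_
  · intro t ht
    obtain ⟨hPt, t', hPt', h1, h2, h3⟩ := (hp t).1 ht
    refine ⟨(hΛ _ _ _).2 (by simpa only [Int.cast_natCast, ZMod.natCast_zmod_val, Prod.mk.eta] using hPt),
      _, (hΛ ((t'.1.val : ℕ) : ℤ) ((t'.2.1.val : ℕ) : ℤ) ((t'.2.2.val : ℕ) : ℤ)).2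
        (by simpa only [Int.cast_natCast, ZMod.natCast_zmod_val, Prod.mk.eta] using hPt'), ?_⟩
    rw [coords_mul_sub_one hθ, hC, hdvd, hdvd, hdvd]
    push_cast
    simp only [ZMod.natCast_zmod_val]
    exact ⟨by linear_combination h1, by linear_combination h2, by linear_combination h3⟩
  · intro t t' _ _ h
    rw [show (((t.1.val : ℕ) : ℤ) : K) + (((t.2.1.val : ℕ) : ℤ) : K) * θ + (((t.2.2.val : ℕ) : ℤ) : K) * θ ^ 2 -
        ((((t'.1.val : ℕ) : ℤ) : K) + (((t'.2.1.val : ℕ) : ℤ) : K) * θ + (((t'.2.2.val : ℕ) : ℤ) : K) * θ ^ 2) =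
        (((t.1.val : ℕ) - (t'.1.val : ℕ) : ℤ) : K) + (((t.2.1.val : ℕ) - (t'.2.1.val : ℕ) : ℤ) : K) * θ +
          (((t.2.2.val : ℕ) - (t'.2.2.val : ℕ) : ℤ) : K) * θ ^ 2 by push_cast; ring, hC, hdvd, hdvd, hdvd] at h
    push_cast at h
    simp only [ZMod.natCast_zmod_val] at h
    obtain ⟨h1, h2, h3⟩ := h
    exact Prod.ext (sub_eq_zero.1 h1) (Prod.ext (sub_eq_zero.1 h2) (sub_eq_zero.1 h3))
  · rintro a ha ⟨a', ha', hinv⟩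
    obtain ⟨u, v, w, rfl⟩ := exists_coords_of_mem_span₁ (hΛ₁ ha)
    obtain ⟨u', v', w', rfl⟩ := exists_coords_of_mem_span₁ (hΛ₁ ha')
    refine ⟨((u : ZMod n), (v : ZMod n), (w : ZMod n)),
      (hp _).2 ⟨(hΛ u v w).1 ha, ((u' : ZMod n), (v' : ZMod n), (w' : ZMod n)), (hΛ u' v' w').1 ha', ?_⟩, ?_⟩
    · rw [coords_mul_sub_one hθ, hC, hdvd, hdvd, hdvd] at hinv
      push_cast at hinv
      obtain ⟨h1, h2, h3⟩ := hinv
      exact ⟨by linear_combination h1, by linear_combination h2, by linear_combination h3⟩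
    · rw [show ((((u : ZMod n).val : ℕ) : ℤ) : K) + ((((v : ZMod n).val : ℕ) : ℤ) : K) * θ +
          ((((w : ZMod n).val : ℕ) : ℤ) : K) * θ ^ 2 - ((u : K) + v * θ + w * θ ^ 2) =
          (((((u : ZMod n).val : ℕ) : ℤ) - u : ℤ) : K) + (((((v : ZMod n).val : ℕ) : ℤ) - v : ℤ) : K) * θ +
            (((((w : ZMod n).val : ℕ) : ℤ) - w : ℤ) : K) * θ ^ 2 by push_cast; ring, hC]
      exact ⟨dvd_val_sub u, dvd_val_sub v, dvd_val_sub w⟩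

/-- **`|(Λ_1/C_3)^{unit}| = 4`** (`C_3 = 2Λ_1`; the invertible residues are those with odd constant coordinate).
[cite: HertlingLarabi2026b, §8 («`|(Λ_1/C_3)^{unit}| = 4`»), chunk p0025] -/
theorem natCard_unitsMod_span₁_C₃ (hθ : aeval θ (MonicCubic.poly 2 2 2) = 0) (h3 : finrank ℚ K = 3) :
    Nat.card (Quot fun a b : {a : K // a ∈ span ℤ ({1, θ, θ ^ 2} : Set K) ∧
        ∃ a' ∈ span ℤ ({1, θ, θ ^ 2} : Set K), a * a' - 1 ∈ span ℤ ({2, 2 * θ, 2 * θ ^ 2} : Set K)} =>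
      a.1 - b.1 ∈ span ℤ ({2, 2 * θ, 2 * θ ^ 2} : Set K)) = 4 := by
  have hli := linearIndependent_one_theta_sq hθ h3
  rw [natCard_unitsMod_eq_card_coords hθ (n := 2) (fun _ => True) (fun t => t.1 = 1)
    (fun u v w => iff_of_true (coords_mem_span₁ u v w) trivial) le_rfl
    (fun u v w => by simpa using mem_C₃_iff hli u v w) (by decide)]
  rfl

/-- **`|(Λ_3/C_3)^{unit}| = 1`.** [cite: HertlingLarabi2026b, §8 («`(Λ_3/C_3)^{unit} ≅ {[1]}`, `|(Λ_3/C_3)^{unit}| = 1`»), chunk p0025] -/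
theorem natCard_unitsMod_span₃_C₃ (hθ : aeval θ (MonicCubic.poly 2 2 2) = 0) (h3 : finrank ℚ K = 3) :
    Nat.card (Quot fun a b : {a : K // a ∈ span ℤ ({1, 2 * θ, 2 * θ ^ 2} : Set K) ∧
        ∃ a' ∈ span ℤ ({1, 2 * θ, 2 * θ ^ 2} : Set K), a * a' - 1 ∈ span ℤ ({2, 2 * θ, 2 * θ ^ 2} : Set K)} =>
      a.1 - b.1 ∈ span ℤ ({2, 2 * θ, 2 * θ ^ 2} : Set K)) = 1 := by
  have hli := linearIndependent_one_theta_sq hθ h3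
  have hdvd : ∀ z : ℤ, (2 : ℤ) ∣ z ↔ ((z : ZMod 2)) = 0 := fun z => (ZMod.intCast_zmod_eq_zero_iff_dvd z 2).symm
  rw [natCard_unitsMod_eq_card_coords hθ (n := 2) (fun t => t.2.1 = 0 ∧ t.2.2 = 0)
    (fun t => t.1 = 1 ∧ t.2.1 = 0 ∧ t.2.2 = 0)
    (fun u v w => by rw [mem_span₃_iff hli, hdvd, hdvd]) (fun x hx => span₂_le_span₁ θ (span₃_le_span₂ θ hx))
    (fun u v w => by simpa using mem_C₃_iff hli u v w) (by decide)]
  rfl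

/-- **`|(Λ_1/C_4)^{unit}| = 32`** (`C_4 = 4Λ_1`). [cite: HertlingLarabi2026b, §8 («`|(Λ_1/C_4)^{unit}| = 32`»), chunk p0025] -/
theorem natCard_unitsMod_span₁_C₄ (hθ : aeval θ (MonicCubic.poly 2 2 2) = 0) (h3 : finrank ℚ K = 3) :
    Nat.card (Quot fun a b : {a : K // a ∈ span ℤ ({1, θ, θ ^ 2} : Set K) ∧
        ∃ a' ∈ span ℤ ({1, θ, θ ^ 2} : Set K), a * a' - 1 ∈ span ℤ ({4, 4 * θ, 4 * θ ^ 2} : Set K)} =>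
      a.1 - b.1 ∈ span ℤ ({4, 4 * θ, 4 * θ ^ 2} : Set K)) = 32 := by
  have hli := linearIndependent_one_theta_sq hθ h3
  rw [natCard_unitsMod_eq_card_coords hθ (n := 4) (fun _ => True) (fun t => t.1 * t.1 = 1)
    (fun u v w => iff_of_true (coords_mem_span₁ u v w) trivial) le_rfl
    (fun u v w => by simpa using mem_C₄_iff hli u v w) (by decide +kernel)]
  rfl

omit [NumberField K] in
/-- `2 ∣ v` iff `v mod 4 ∈ {0, 2}`. [folklore] -/
private theorem two_dvd_iff_zmod_four (v : ℤ) : 2 ∣ v ↔ ((v : ZMod 4) = 0 ∨ (v : ZMod 4) = 2) := by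
  constructor
  · rintro ⟨k, rfl⟩
    push_cast
    have : ∀ x : ZMod 4, 2 * x = 0 ∨ 2 * x = 2 := by decide
    exact this _
  · rintro (h | h)
    · exact dvd_trans ⟨2, by norm_num⟩ ((ZMod.intCast_zmod_eq_zero_iff_dvd v 4).1 h)
    · have h' : ((v : ℤ) : ZMod 4) = ((2 : ℤ) : ZMod 4) := by rw [h]; norm_num
      obtain ⟨k, hk⟩ := (ZMod.intCast_eq_intCast_iff_dvd_sub v 2 4).1 h'
      exact ⟨1 - 2 * k, by omega⟩

/-- **`|(Λ_4/C_4)^{unit}| = 4`.** [cite: HertlingLarabi2026b, §8 («`(Λ_4/C_4)^{unit} ≅ {±[1], ±[1+2β]}`, `|(Λ_4/C_4)^{unit}| = 4`»), chunk p0025] -/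
theorem natCard_unitsMod_span₄_C₄ (hθ : aeval θ (MonicCubic.poly 2 2 2) = 0) (h3 : finrank ℚ K = 3) :
    Nat.card (Quot fun a b : {a : K // a ∈ span ℤ ({1, 2 * θ, 4 * θ ^ 2} : Set K) ∧
        ∃ a' ∈ span ℤ ({1, 2 * θ, 4 * θ ^ 2} : Set K), a * a' - 1 ∈ span ℤ ({4, 4 * θ, 4 * θ ^ 2} : Set K)} =>
      a.1 - b.1 ∈ span ℤ ({4, 4 * θ, 4 * θ ^ 2} : Set K)) = 4 := by
  have hli := linearIndependent_one_theta_sq hθ h3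
  have hdvd : ∀ z : ℤ, (4 : ℤ) ∣ z ↔ ((z : ZMod 4)) = 0 := fun z => (ZMod.intCast_zmod_eq_zero_iff_dvd z 4).symm
  rw [natCard_unitsMod_eq_card_coords hθ (n := 4) (fun t => (t.2.1 = 0 ∨ t.2.1 = 2) ∧ t.2.2 = 0)
    (fun t => t.1 * t.1 = 1 ∧ (t.2.1 = 0 ∨ t.2.1 = 2) ∧ t.2.2 = 0)
    (fun u v w => by rw [mem_span₄_iff hli, two_dvd_iff_zmod_four, hdvd])
    (fun x hx => span₂_le_span₁ θ (span₃_le_span₂ θ (span₄_le_span₃ θ hx)))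
    (fun u v w => by simpa using mem_C₄_iff hli u v w) (by decide +kernel)]
  rfl

/-- **Counting `(Λ/C_2)^{unit}` by residues mod `2` of the first two coordinates** (`θ² ∈ C_2`, so the class of
`u + vθ + wθ²` modulo `C_2` is `(u, v) mod 2`). [folklore] -/
private theorem natCard_unitsMod_C₂_eq_card (hθ : aeval θ (MonicCubic.poly 2 2 2) = 0) (h3 : finrank ℚ K = 3)
    {Λ : Submodule ℤ K} (PΛ p : ZMod 2 × ZMod 2 → Prop) [DecidablePred p]
    (hΛ : ∀ u v w : ℤ, (u : K) + v * θ + w * θ ^ 2 ∈ Λ ↔ PΛ ((u : ZMod 2), (v : ZMod 2)))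
    (hΛ₁ : Λ ≤ span ℤ ({1, θ, θ ^ 2} : Set K))
    (hp : ∀ t, p t ↔ PΛ t ∧ ∃ t', PΛ t' ∧ t.1 * t'.1 = 1 ∧ t.1 * t'.2 + t.2 * t'.1 = 0) :
    Nat.card (Quot fun a b : {a : K // a ∈ Λ ∧ ∃ a' ∈ Λ, a * a' - 1 ∈ span ℤ ({2, 2 * θ, θ ^ 2} : Set K)} =>
      a.1 - b.1 ∈ span ℤ ({2, 2 * θ, θ ^ 2} : Set K)) = Fintype.card {t // p t} := by
  have hli := linearIndependent_one_theta_sq hθ h3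
  have hdvd : ∀ z : ℤ, (2 : ℤ) ∣ z ↔ ((z : ZMod 2)) = 0 := fun z => (ZMod.intCast_zmod_eq_zero_iff_dvd z 2).symm
  have h2 : (2 : ZMod 2) = 0 := by decide
  refine natCard_unitsMod_eq_card p
    (fun t => (((t.1.val : ℕ) : ℤ) : K) + (((t.2.val : ℕ) : ℤ) : K) * θ + ((0 : ℤ) : K) * θ ^ 2) ?_ ?_ ?_
  · intro t ht
    obtain ⟨hPt, t', hPt', h1, h2'⟩ := (hp t).1 ht
    refine ⟨(hΛ _ _ 0).2 (by simpa only [Int.cast_natCast, ZMod.natCast_zmod_val, Prod.mk.eta] using hPt),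
      _, (hΛ ((t'.1.val : ℕ) : ℤ) ((t'.2.val : ℕ) : ℤ) 0).2
        (by simpa only [Int.cast_natCast, ZMod.natCast_zmod_val, Prod.mk.eta] using hPt'), ?_⟩
    rw [coords_mul_sub_one hθ, mem_C₂_iff hli, hdvd, hdvd]
    push_cast
    simp only [ZMod.natCast_zmod_val]
    exact ⟨by linear_combination h1, by linear_combination h2'⟩
  · intro t t' _ _ h
    rw [show (((t.1.val : ℕ) : ℤ) : K) + (((t.2.val : ℕ) : ℤ) : K) * θ + ((0 : ℤ) : K) * θ ^ 2 -
        ((((t'.1.val : ℕ) : ℤ) : K) + (((t'.2.val : ℕ) : ℤ) : K) * θ + ((0 : ℤ) : K) * θ ^ 2) =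
        (((t.1.val : ℕ) - (t'.1.val : ℕ) : ℤ) : K) + (((t.2.val : ℕ) - (t'.2.val : ℕ) : ℤ) : K) * θ +
          ((0 : ℤ) : K) * θ ^ 2 by push_cast; ring, mem_C₂_iff hli, hdvd, hdvd] at h
    push_cast at h
    simp only [ZMod.natCast_zmod_val] at h
    exact Prod.ext (sub_eq_zero.1 h.1) (sub_eq_zero.1 h.2)
  · rintro a ha ⟨a', ha', hinv⟩
    obtain ⟨u, v, w, rfl⟩ := exists_coords_of_mem_span₁ (hΛ₁ ha)
    obtain ⟨u', v', w', rfl⟩ := exists_coords_of_mem_span₁ (hΛ₁ ha')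
    refine ⟨((u : ZMod 2), (v : ZMod 2)),
      (hp _).2 ⟨(hΛ u v w).1 ha, ((u' : ZMod 2), (v' : ZMod 2)), (hΛ u' v' w').1 ha', ?_⟩, ?_⟩
    · rw [coords_mul_sub_one hθ, mem_C₂_iff hli, hdvd, hdvd] at hinv
      push_cast at hinv
      obtain ⟨h1, h2'⟩ := hinv
      exact ⟨by linear_combination h1 + ((v : ZMod 2) * w' + w * v' - 2 * w * w') * h2,
        by linear_combination h2' + ((v : ZMod 2) * w' + w * v' - w * w') * h2⟩
    · rw [show ((((u : ZMod 2).val : ℕ) : ℤ) : K) + ((((v : ZMod 2).val : ℕ) : ℤ) : K) * θ + ((0 : ℤ) : K) * θ ^ 2 -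
          ((u : K) + v * θ + w * θ ^ 2) =
          (((((u : ZMod 2).val : ℕ) : ℤ) - u : ℤ) : K) + (((((v : ZMod 2).val : ℕ) : ℤ) - v : ℤ) : K) * θ +
            ((-w : ℤ) : K) * θ ^ 2 by push_cast; ring, mem_C₂_iff hli]
      exact ⟨dvd_val_sub u, dvd_val_sub v⟩

/-- **`|(Λ_1/C_2)^{unit}| = 2`** («`(Λ_1/C_2)^{unit} = {[1], [1+β]}`»). [cite: HertlingLarabi2026b, §8 («`|(Λ_1/C_2)^{unit}| = 2`»), chunk p0025] -/
theorem natCard_unitsMod_span₁_C₂ (hθ : aeval θ (MonicCubic.poly 2 2 2) = 0) (h3 : finrank ℚ K = 3) :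
    Nat.card (Quot fun a b : {a : K // a ∈ span ℤ ({1, θ, θ ^ 2} : Set K) ∧
        ∃ a' ∈ span ℤ ({1, θ, θ ^ 2} : Set K), a * a' - 1 ∈ span ℤ ({2, 2 * θ, θ ^ 2} : Set K)} =>
      a.1 - b.1 ∈ span ℤ ({2, 2 * θ, θ ^ 2} : Set K)) = 2 := by
  rw [natCard_unitsMod_C₂_eq_card hθ h3 (fun _ => True) (fun t => t.1 = 1)
    (fun u v w => iff_of_true (coords_mem_span₁ u v w) trivial) le_rfl (by decide)]
  rfl

/-- **`|(Λ_2/C_2)^{unit}| = 1`** («`(Λ_2/C_2)^{unit} ≅ {[1]}`»). [cite: HertlingLarabi2026b, §8 («`|(Λ_2/C_2)^{unit}| = 1`»), chunk p0025] -/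
theorem natCard_unitsMod_span₂_C₂ (hθ : aeval θ (MonicCubic.poly 2 2 2) = 0) (h3 : finrank ℚ K = 3) :
    Nat.card (Quot fun a b : {a : K // a ∈ span ℤ ({1, 2 * θ, θ ^ 2} : Set K) ∧
        ∃ a' ∈ span ℤ ({1, 2 * θ, θ ^ 2} : Set K), a * a' - 1 ∈ span ℤ ({2, 2 * θ, θ ^ 2} : Set K)} =>
      a.1 - b.1 ∈ span ℤ ({2, 2 * θ, θ ^ 2} : Set K)) = 1 := by
  have hli := linearIndependent_one_theta_sq hθ h3
  have hdvd : ∀ z : ℤ, (2 : ℤ) ∣ z ↔ ((z : ZMod 2)) = 0 := fun z => (ZMod.intCast_zmod_eq_zero_iff_dvd z 2).symm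
  rw [natCard_unitsMod_C₂_eq_card hθ h3 (fun t => t.2 = 0) (fun t => t.1 = 1 ∧ t.2 = 0)
    (fun u v w => by rw [mem_span₂_iff hli, hdvd]) (span₂_le_span₁ θ) (by decide)]
  rfl

/-! ## §5 The class numbers `|G([Λ_2]_ε)| = |G([Λ_3]_ε)| = 1`, `|G([Λ_4]_ε)| = 2` (HL §8 via Theorem 5.12) -/

/-- **`|G([Λ_2]_ε)| = 1`**: `|G([Λ_2]_ε)| · |(Λ_2/C_2)^{unit}| · [Λ_1^{unit} : Λ_2^{unit}] = |G([Λ_1]_ε)| · |(Λ_1/C_2)^{unit}|`,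
i.e. `|G([Λ_2]_ε)| · 1 · 2 = 1 · 2` (the tree's `natCard_quot_pic_mul_mul_index_eq`, HL Thm. 5.12 (e)).
[cite: HertlingLarabi2026b, §8 («`|G([Λ_2]_ε)| = … = 1`»), chunk p0025] -/
theorem natCard_pic_span₂_eq_one (hθ : aeval θ (MonicCubic.poly 2 2 2) = 0) (h3 : finrank ℚ K = 3) :
    Nat.card (Quot fun M M' : {M : Submodule ℤ K //
        IsFullLattice K M ∧ M / M = span ℤ ({1, 2 * θ, θ ^ 2} : Set K) ∧ M * ((M / M) / M) = M / M} =>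
      ∃ u : Kˣ, u • M.1 = M'.1) = 1 := by
  have hβ := theta_rel_two hθ
  have hli := linearIndependent_one_theta_sq hθ h3
  have h := natCard_quot_pic_mul_mul_index_eq (A := K) (isFullLattice_span₁ hθ h3) (one_mem_span₁ θ)
    (span₁_mul_le hβ) (isFullLattice_span₂ hθ h3) (one_mem_span₂ θ) (span₂_mul_le hβ) (span₂_le_span₁ θ)
  rw [span₂_div_span₁ hβ hli, natCard_unitsMod_span₂_C₂ hθ h3, natCard_unitsIndex_span₂ hθ h3,
    natCard_pic_span₁_eq_one hθ h3, natCard_unitsMod_span₁_C₂ hθ h3] at h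
  omega

/-- **`|G([Λ_3]_ε)| = 1`**: `|G([Λ_3]_ε)| · 1 · 4 = 1 · 4`. [cite: HertlingLarabi2026b, §8 («`|G([Λ_3]_ε)| = … = 1`»), chunk p0025] -/
theorem natCard_pic_span₃_eq_one (hθ : aeval θ (MonicCubic.poly 2 2 2) = 0) (h3 : finrank ℚ K = 3) :
    Nat.card (Quot fun M M' : {M : Submodule ℤ K //
        IsFullLattice K M ∧ M / M = span ℤ ({1, 2 * θ, 2 * θ ^ 2} : Set K) ∧ M * ((M / M) / M) = M / M} =>
      ∃ u : Kˣ, u • M.1 = M'.1) = 1 := by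
  have hβ := theta_rel_two hθ
  have hli := linearIndependent_one_theta_sq hθ h3
  have h := natCard_quot_pic_mul_mul_index_eq (A := K) (isFullLattice_span₁ hθ h3) (one_mem_span₁ θ)
    (span₁_mul_le hβ) (isFullLattice_span₃ hθ h3) (one_mem_span₃ θ) (span₃_mul_le hβ)
    (fun x hx => span₂_le_span₁ θ (span₃_le_span₂ θ hx))
  rw [span₃_div_span₁ hβ hli, natCard_unitsMod_span₃_C₃ hθ h3, natCard_unitsIndex_span₃ hθ h3,
    natCard_pic_span₁_eq_one hθ h3, natCard_unitsMod_span₁_C₃ hθ h3] at h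
  omega

/-- **`|G([Λ_4]_ε)| = 2`**: `|G([Λ_4]_ε)| · |(Λ_4/C_4)^{unit}| · [Λ_1^{unit} : Λ_4^{unit}] = |G([Λ_1]_ε)| · |(Λ_1/C_4)^{unit}|`,
i.e. `|G([Λ_4]_ε)| · 4 · 4 = 1 · 32` — HL's «`|G([Λ_4]_ε)| = ¼ · 32/4 = 2`»; with `smul_span₄_ne_spanL₄`
(`[L_4]_ε ≠ [Λ_4]_ε`, `…CubicUnits`) this is «`G([Λ_4]_ε) = {[Λ_4]_ε, [L_4]_ε}`».
[cite: HertlingLarabi2026b, §8 («`|G([Λ_4]_ε)| = … = 2`», «`G([Λ_4]_ε) = {[Λ_4]_ε, [L_4]_ε}`»), chunks p0025–p0026] -/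
theorem natCard_pic_span₄_eq_two (hθ : aeval θ (MonicCubic.poly 2 2 2) = 0) (h3 : finrank ℚ K = 3) :
    Nat.card (Quot fun M M' : {M : Submodule ℤ K //
        IsFullLattice K M ∧ M / M = span ℤ ({1, 2 * θ, 4 * θ ^ 2} : Set K) ∧ M * ((M / M) / M) = M / M} =>
      ∃ u : Kˣ, u • M.1 = M'.1) = 2 := by
  have hβ := theta_rel_two hθ
  have hli := linearIndependent_one_theta_sq hθ h3
  have h := natCard_quot_pic_mul_mul_index_eq (A := K) (isFullLattice_span₁ hθ h3) (one_mem_span₁ θ)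
    (span₁_mul_le hβ) (isFullLattice_span₄ hθ h3) (one_mem_span₄ θ) (span₄_mul_le hβ)
    (fun x hx => span₂_le_span₁ θ (span₃_le_span₂ θ (span₄_le_span₃ θ hx)))
  rw [span₄_div_span₁ hβ hli, natCard_unitsMod_span₄_C₄ hθ h3, natCard_unitsIndex_span₄ hθ h3,
    natCard_pic_span₁_eq_one hθ h3, natCard_unitsMod_span₁_C₄ hθ h3] at h
  omega

/-! ## §6 `τ₁ = τ₂ = τ₄ = 1`: over the CYCLIC orders `Λ₁ = ℤ[θ]`, `Λ₂ = ℤ[θ²]`, `Λ₄ = ℤ[2θ]` every full lattice is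
invertible (HL Thm. 4.12), so the `ε`-classes over them number `|G([Λᵢ]_ε)| = 1, 1, 2` (HL §8, chunk p0024)

HL: «For `i ∈ {1, 2, 3, 4}` denote by `τ_i := |{[L]_w | 𝒪(L) = Λ_i}|` the number of `w`-equivalence classes of full
lattices with order `Λ_i`. `Λ_1` and `Λ_4` are cyclic orders, so `τ_1 = τ_4 = 1` by Theorem 4.12. `Λ_2` satisfies the
hypothesis in Theorem 4.9, namely `Λ_1 = Λ_2 + βΛ_2`, so `τ_2 = τ_1 = 1`.»  Here `τ_2 = 1` is obtained from Theorem 4.12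
as well: `Λ_2 = ⟨1, 2β, β²⟩ = ℤ[β²]` is cyclic (`2β = β⁴ − 2β² − 4`).  (`τ_3 = 2`, Faddeev's Theorem 5.7, is not treated.) -/

omit [NumberField K] in
/-- A multiplicatively closed `ℤ`-lattice containing `1` and `a` contains `ℤ[a]`. [folklore] -/
private theorem toSubmodule_adjoin_le {Λ : Submodule ℤ K} (h1 : (1 : K) ∈ Λ) (hmul : Λ * Λ ≤ Λ) {a : K} (ha : a ∈ Λ) :
    Subalgebra.toSubmodule (Algebra.adjoin ℤ {a}) ≤ Λ := by
  let S : Subalgebra ℤ K :=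
    { carrier := Λ
      mul_mem' := fun hx hy => hmul (Submodule.mul_mem_mul hx hy)
      one_mem' := h1
      add_mem' := fun hx hy => Λ.add_mem hx hy
      zero_mem' := Λ.zero_mem
      algebraMap_mem' := fun n => by
        rw [Algebra.algebraMap_eq_smul_one]
        exact Λ.smul_mem n h1 }
  have h : Algebra.adjoin ℤ {a} ≤ S := Algebra.adjoin_le (Set.singleton_subset_iff.2 ha)
  exact fun x hx => h hx

omit [NumberField K] in
/-- **`Λ₁ = ⟨1, θ, θ²⟩ = ℤ[θ]` is a cyclic order.** [cite: HertlingLarabi2026b, §8 («`Λ_1 := Λ_max = ℤ[β]`», «`Λ_1` and `Λ_4` are cyclic orders»), chunk p0024] -/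
theorem span₁_eq_toSubmodule_adjoin (hθ : aeval θ (MonicCubic.poly 2 2 2) = 0) :
    span ℤ ({1, θ, θ ^ 2} : Set K) = Subalgebra.toSubmodule (Algebra.adjoin ℤ {θ}) := by
  refine le_antisymm (span_le.2 ?_)
    (toSubmodule_adjoin_le (one_mem_span₁ θ) (span₁_mul_le (theta_rel_two hθ)) (subset_span (by simp)))
  rintro x (rfl | rfl | rfl)
  · exact Subalgebra.one_mem _
  · exact Algebra.subset_adjoin rfl
  · exact Subalgebra.pow_mem (Algebra.adjoin ℤ {θ}) (Algebra.subset_adjoin rfl) 2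

omit [NumberField K] in
/-- **`Λ₂ = ⟨1, 2θ, θ²⟩ = ℤ[θ²]` is a cyclic order** (`2θ = θ⁴ − 2θ² − 4`). [cite: HertlingLarabi2026b, §8 Lemma 8.1 («`Λ_2 = ⟨1, 2β, β²⟩_ℤ`»), chunk p0024] -/
theorem span₂_eq_toSubmodule_adjoin (hθ : aeval θ (MonicCubic.poly 2 2 2) = 0) :
    span ℤ ({1, 2 * θ, θ ^ 2} : Set K) = Subalgebra.toSubmodule (Algebra.adjoin ℤ {θ ^ 2}) := by
  have hβ := theta_rel_two hθ
  refine le_antisymm (span_le.2 ?_)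
    (toSubmodule_adjoin_le (one_mem_span₂ θ) (span₂_mul_le hβ) (subset_span (by simp)))
  have hsq : θ ^ 2 ∈ Algebra.adjoin ℤ ({θ ^ 2} : Set K) := Algebra.subset_adjoin rfl
  rintro x (rfl | rfl | rfl)
  · exact Subalgebra.one_mem _
  · have h : 2 * θ = (θ ^ 2) ^ 2 - 2 * θ ^ 2 - 4 := by linear_combination (2 - θ) * hβ
    rw [SetLike.mem_coe, Subalgebra.mem_toSubmodule, h]
    exact Subalgebra.sub_mem _ (Subalgebra.sub_mem _ (Subalgebra.pow_mem _ hsq 2)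
      (Subalgebra.mul_mem _ (Subalgebra.natCast_mem _ 2) hsq)) (Subalgebra.natCast_mem _ 4)
  · exact hsq

omit [NumberField K] in
/-- **`Λ₄ = ⟨1, 2θ, 4θ²⟩ = ℤ[2θ] = ℤ[α]` is a cyclic order.** [cite: HertlingLarabi2026b, §8 («`Λ_4 = ℤ[2β] = ⟨1, 2β, 4β²⟩_ℤ`»), chunk p0024] -/
theorem span₄_eq_toSubmodule_adjoin (hθ : aeval θ (MonicCubic.poly 2 2 2) = 0) :
    span ℤ ({1, 2 * θ, 4 * θ ^ 2} : Set K) = Subalgebra.toSubmodule (Algebra.adjoin ℤ {2 * θ}) := by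
  have hβ := theta_rel_two hθ
  refine le_antisymm (span_le.2 ?_)
    (toSubmodule_adjoin_le (one_mem_span₄ θ) (span₄_mul_le hβ) (subset_span (by simp)))
  have h2 : 2 * θ ∈ Algebra.adjoin ℤ ({2 * θ} : Set K) := Algebra.subset_adjoin rfl
  rintro x (rfl | rfl | rfl)
  · exact Subalgebra.one_mem _
  · exact h2
  · have h : 4 * θ ^ 2 = (2 * θ) ^ 2 := by ring
    rw [SetLike.mem_coe, Subalgebra.mem_toSubmodule, h]
    exact Subalgebra.pow_mem _ h2 2

/-- **THEOREM 4.12 for the cyclic orders `Λ₁, Λ₂, Λ₄`: every full lattice `L` with `𝒪(L) = Λᵢ` is invertible.**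
[cite: HertlingLarabi2026b, §8 («`Λ_1` and `Λ_4` are cyclic orders, so `τ_1 = τ_4 = 1` by Theorem 4.12») and §4 Thm. 4.12, chunks p0024, p0008] -/
theorem mul_div_div_eq_of_div_self_eq_cyclic (hθ : aeval θ (MonicCubic.poly 2 2 2) = 0) (h3 : finrank ℚ K = 3)
    {L : Submodule ℤ K} (hL : IsFullLattice K L)
    (hO : L / L = span ℤ ({1, θ, θ ^ 2} : Set K) ∨ L / L = span ℤ ({1, 2 * θ, θ ^ 2} : Set K) ∨
      L / L = span ℤ ({1, 2 * θ, 4 * θ ^ 2} : Set K)) :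
    L * ((L / L) / L) = L / L := by
  rcases hO with hO | hO | hO
  · have ha : IsFullLattice K (Subalgebra.toSubmodule (Algebra.adjoin ℤ {θ})) := by
      rw [← span₁_eq_toSubmodule_adjoin hθ]; exact isFullLattice_span₁ hθ h3
    rw [span₁_eq_toSubmodule_adjoin hθ] at hO
    rw [hO]; exact mul_div_eq_of_div_self_eq_adjoin ha hL hO
  · have ha : IsFullLattice K (Subalgebra.toSubmodule (Algebra.adjoin ℤ {θ ^ 2})) := by
      rw [← span₂_eq_toSubmodule_adjoin hθ]; exact isFullLattice_span₂ hθ h3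
    rw [span₂_eq_toSubmodule_adjoin hθ] at hO
    rw [hO]; exact mul_div_eq_of_div_self_eq_adjoin ha hL hO
  · have ha : IsFullLattice K (Subalgebra.toSubmodule (Algebra.adjoin ℤ {2 * θ})) := by
      rw [← span₄_eq_toSubmodule_adjoin hθ]; exact isFullLattice_span₄ hθ h3
    rw [span₄_eq_toSubmodule_adjoin hθ] at hO
    rw [hO]; exact mul_div_eq_of_div_self_eq_adjoin ha hL hO

omit [NumberField K] in
/-- If every full lattice with order `Λ` is invertible, there is exactly one `w`-class over `Λ` (`τ(Λ) = 1`): on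
invertible lattices `∼_w` is equality of orders (HL 2026 Thm. 4.4 (d)). [cite: HertlingLarabi2026, §4 Thm. 4.4 (b), (d), chunks p0009–p0010] -/
theorem natCard_quot_weak_eq_one_of_forall_invertible {Λ : Submodule ℤ K} (hΛ : IsFullLattice K Λ)
    (h1 : (1 : K) ∈ Λ) (hΛΛ : Λ * Λ ≤ Λ)
    (hinv : ∀ L : Submodule ℤ K, IsFullLattice K L → L / L = Λ → L * ((L / L) / L) = L / L) :
    Nat.card (Quot fun L L' : {L : Submodule ℤ K // IsFullLattice K L ∧ L / L = Λ} =>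
      (1 : K) ∈ (L.1 / L'.1) * (L'.1 / L.1)) = 1 := by
  rw [Nat.card_eq_one_iff_unique]
  refine ⟨⟨?_⟩, ⟨Quot.mk _ ⟨Λ, hΛ, div_self_eq_of_one_mem h1 hΛΛ⟩⟩⟩
  rintro ⟨L⟩ ⟨L'⟩
  exact Quot.sound ((one_mem_div_mul_div_iff_div_self_eq_of_invertible (hinv L.1 L.2.1 L.2.2)
    (hinv L'.1 L'.2.1 L'.2.2)).2 (by rw [L.2.2, L'.2.2]))

/-- **`τ₁ = 1` and `#{[L]_ε | 𝒪(L) = Λ₁} = |G([Λ₁]_ε)| = 1`: up to multiplication by units of `K`, `Λ₁` is the only full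
lattice with order `Λ₁`.** [cite: HertlingLarabi2026b, §8 («`τ_1 = τ_4 = 1` by Theorem 4.12», «`|G([Λ_max]_ε)| = 1`»), chunk p0024] -/
theorem natCard_quot_span₁_eq_one (hθ : aeval θ (MonicCubic.poly 2 2 2) = 0) (h3 : finrank ℚ K = 3) :
    Nat.card (Quot fun L L' : {L : Submodule ℤ K // IsFullLattice K L ∧ L / L = span ℤ ({1, θ, θ ^ 2} : Set K)} =>
      ∃ u : Kˣ, u • L.1 = L'.1) = 1 := by
  have hβ := theta_rel_two hθ
  rw [natCard_quot_div_self_eq_eq_of_natCard_quot_weak_eq_one (isFullLattice_span₁ hθ h3)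
    (natCard_quot_weak_eq_one_of_forall_invertible (isFullLattice_span₁ hθ h3) (one_mem_span₁ θ) (span₁_mul_le hβ)
      fun L hL hO => mul_div_div_eq_of_div_self_eq_cyclic hθ h3 hL (Or.inl hO)),
    natCard_pic_span₁_eq_one hθ h3]

/-- **`τ₂ = 1` and `#{[L]_ε | 𝒪(L) = Λ₂} = |G([Λ₂]_ε)| = 1`.** [cite: HertlingLarabi2026b, §8 («`τ_2 = τ_1 = 1`», «`|G([Λ_2]_ε)| = 1`»), chunks p0024–p0025] -/
theorem natCard_quot_span₂_eq_one (hθ : aeval θ (MonicCubic.poly 2 2 2) = 0) (h3 : finrank ℚ K = 3) :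
    Nat.card (Quot fun L L' : {L : Submodule ℤ K // IsFullLattice K L ∧ L / L = span ℤ ({1, 2 * θ, θ ^ 2} : Set K)} =>
      ∃ u : Kˣ, u • L.1 = L'.1) = 1 := by
  have hβ := theta_rel_two hθ
  rw [natCard_quot_div_self_eq_eq_of_natCard_quot_weak_eq_one (isFullLattice_span₂ hθ h3)
    (natCard_quot_weak_eq_one_of_forall_invertible (isFullLattice_span₂ hθ h3) (one_mem_span₂ θ) (span₂_mul_le hβ)
      fun L hL hO => mul_div_div_eq_of_div_self_eq_cyclic hθ h3 hL (Or.inr (Or.inl hO))),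
    natCard_pic_span₂_eq_one hθ h3]

/-- **`τ₄ = 1` and `#{[L]_ε | 𝒪(L) = Λ₄} = |G([Λ₄]_ε)| = 2`: up to units, the full lattices with order `Λ₄ = ℤ[α]` are
exactly `Λ₄` and `L₄`** (two classes, and `[L₄]_ε ≠ [Λ₄]_ε` by `smul_span₄_ne_spanL₄`).
[cite: HertlingLarabi2026b, §8 («`τ_1 = τ_4 = 1` by Theorem 4.12», «`G([Λ_4]_ε) = {[Λ_4]_ε, [L_4]_ε}`»), chunks p0024–p0026] -/
theorem natCard_quot_span₄_eq_two (hθ : aeval θ (MonicCubic.poly 2 2 2) = 0) (h3 : finrank ℚ K = 3) :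
    Nat.card (Quot fun L L' : {L : Submodule ℤ K //
        IsFullLattice K L ∧ L / L = span ℤ ({1, 2 * θ, 4 * θ ^ 2} : Set K)} => ∃ u : Kˣ, u • L.1 = L'.1) = 2 := by
  have hβ := theta_rel_two hθ
  rw [natCard_quot_div_self_eq_eq_of_natCard_quot_weak_eq_one (isFullLattice_span₄ hθ h3)
    (natCard_quot_weak_eq_one_of_forall_invertible (isFullLattice_span₄ hθ h3) (one_mem_span₄ θ) (span₄_mul_le hβ)
      fun L hL hO => mul_div_div_eq_of_div_self_eq_cyclic hθ h3 hL (Or.inr (Or.inr hO))),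
    natCard_pic_span₄_eq_two hθ h3]

end Literature.NumberTheory.ComplexMultiplication.FiniteQAlgebraLattice.DTZCubic

end
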